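import Summits.NavierStokesRegularity.NavierStokesRegularity.Theorems.TypeICertificateLadderTargetRotatingConjugateDensityPositive
import Summits.NavierStokesRegularity.NavierStokesRegularity.Theorems.TypeICertificateLadderTargetRotatingConjugateDensityBounds
import Summits.NavierStokesRegularity.NavierStokesRegularity.Theorems.TypeICertificateLadderTargetRotatingConjugateDensityGradBound
import Literature.Analysis.FluidPDE.PineauVicolRSSChaeWolf
import Literature.Analysis.FluidPDE.PineauVicolCylinderRegularity
import Mathlib.Analysis.SpecialFunctions.Gaussian.FourierTransform
import HarnessLib

/-!
# Stub B2 `stub_rotatingConjugateDensity` of line `killing-twisted-bernoulli-solitons`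
# (crux `Target` ≡ `TypeICertificateLadder.NoTypeIBlowup`, stmt-NavierStokesRegularity-1217)

**The rotating conjugate density** (Pineau–Vicol 2026, Prop. 5.1 + Remark 5.2 in the rotating
gauge, arXiv:2607.09619): for the profile `U = u(·,−1)` of a Type-I rotated self-similar
classical solution `u = pvAnsatz α U` on `[−1,0)` with `|u| ≤ C₀/(|x| + √(−t))` and `|α| ≤ A`,
there is a `C²`, positive, normalised (`∫ m = 1`) kernel element of the adjoint rotating-frame
operator, `Δm + ∇·(m(U + ½y − αJy)) = 0` (`J = rotGen`), with the Gaussian bounds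
`c e^{−7|y|²/16} ≤ m ≤ M₁ e^{−|y|²/16}`, `c, M₁` depending on `C₀, A` only, and a Gaussian gradient
bound `‖Dm‖ ≤ M₂ e^{−|y|²/32}`. Assembly of the sibling files `…Hardy`, `…Weak` (twisted
Lax–Milgram on `H¹(γ)`), `…Smooth` (Hörmander), `…Kato`, `…Positive` (Kato + Hopf), `…Decay`,
`…Bounds` (Harnack chains and barriers, `ε = ¾`), `…Gradient`, `…GradBound`, with the inputs
`DriftHyp U C₀` (`driftHyp_of_rss`: Remark 1.2 / (1.9)) and `‖DU‖ ≤ K` (Lemma 7.1 after the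
backward extension of footnote 13, `exists_norm_fderiv_le_of_rss`); normalisation
`m = γ v / ∫ γ v` with `∫ γ v` pinched between `v(0)`-multiples of `∫ e^{−7|y|²/16}` and
`∫ e^{−|y|²/16}`.

References: B. Pineau, V. Vicol, arXiv:2607.09619 (2026), Prop. 5.1, Remark 5.2, (5.3), Lemma 7.1,
footnote 13, Remarks 1.2–1.5.
-/

noncomputable section

open MeasureTheory TopologicalSpace Set Function Filter Topology InnerProductSpace Real Metric
open scoped RealInnerProductSpace ENNReal NNReal ContDiff

namespace Summit.NavierStokesRegularity.NavierStokesRegularity.Theorems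

open Literature.Analysis.FluidPDE Literature.Analysis.FluidPDE.PineauVicol2026
open scoped Laplacian

section Profile

variable {C₀ α : ℝ} {u : ℝ → EuclideanSpace ℝ (Fin 3) → EuclideanSpace ℝ (Fin 3)}
  {p : ℝ → EuclideanSpace ℝ (Fin 3) → ℝ} {U : EuclideanSpace ℝ (Fin 3) → EuclideanSpace ℝ (Fin 3)}

/-- The profile is the time slice `t = −1` of the physical field. [cite: PineauVicol2026, Remark 1.3 (u(·,−1) = U)] -/
theorem profile_eq_slice (hans : ∀ t ∈ Ico (-1 : ℝ) 0, ∀ x, u t x = pvAnsatz α (fun y _ => U y) t x) :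
    U = u (-1) := by
  funext y
  have hmem : (-1 : ℝ) ∈ Ico (-1 : ℝ) 0 := ⟨le_rfl, by norm_num⟩
  rw [hans (-1) hmem y, pvAnsatz_neg_one]

/-- **The RSS profile is an admissible drift** (`DriftHyp U C₀`): smooth, divergence free,
`|U| ≤ C₀`, `|⟪U, y⟫| ≤ C₀`. [cite: PineauVicol2026, (1.8b)–(1.9) and Remark 1.2] -/
theorem driftHyp_of_rss (hsol : IsClassicalNSSolutionOn (Ico (-1) 0) 1 0 u p)
    (hI : ∀ t ∈ Ico (-1 : ℝ) 0, ∀ x, ‖u t x‖ ≤ C₀ / (‖x‖ + Real.sqrt (-t)))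
    (hans : ∀ t ∈ Ico (-1 : ℝ) 0, ∀ x, u t x = pvAnsatz α (fun y _ => U y) t x) :
    DriftHyp U C₀ := by
  have hmem : (-1 : ℝ) ∈ Ico (-1 : ℝ) 0 := ⟨le_rfl, by norm_num⟩
  have hUeq : U = u (-1) := profile_eq_slice hans
  have hprof : ∀ y, ‖U y‖ ≤ C₀ / (‖y‖ + 1) := profile_bound_of_typeI hI hans
  have hC₀ : 0 ≤ C₀ := by
    have h := hprof 0
    rw [norm_zero, zero_add, div_one] at h
    exact (norm_nonneg _).trans h
  refine ⟨?_, ?_, fun y => ?_, fun y => ?_⟩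
  · rw [hUeq]; exact hsol.contDiff_velocity hmem
  · rw [hUeq]; exact hsol.divFree (-1) hmem
  · refine (hprof y).trans ?_
    rw [div_le_iff₀ (by positivity)]
    nlinarith [norm_nonneg y]
  · have h1 : |⟪U y, y⟫| ≤ ‖U y‖ * ‖y‖ := abs_real_inner_le_norm _ _
    have h2 : ‖U y‖ * ‖y‖ ≤ C₀ / (‖y‖ + 1) * ‖y‖ := mul_le_mul_of_nonneg_right (hprof y) (norm_nonneg _)
    have h3 : C₀ / (‖y‖ + 1) * ‖y‖ ≤ C₀ := by
      rw [div_mul_eq_mul_div, div_le_iff₀ (by positivity)]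
      nlinarith [norm_nonneg y]
    linarith

/-- **Global gradient bound for the RSS profile** (Lemma 7.1 with `n = 1` at `t = −1`, after the
backward extension of footnote 13): `‖DU(y)‖ ≤ K` for all `y`, some `K`. [cite: PineauVicol2026, Lemma 7.1 and footnote 13] -/
theorem exists_norm_fderiv_le_of_rss (hsol : IsClassicalNSSolutionOn (Ico (-1) 0) 1 0 u p)
    (hI : ∀ t ∈ Ico (-1 : ℝ) 0, ∀ x, ‖u t x‖ ≤ C₀ / (‖x‖ + Real.sqrt (-t)))
    (hans : ∀ t ∈ Ico (-1 : ℝ) 0, ∀ x, u t x = pvAnsatz α (fun y _ => U y) t x) :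
    ∃ K : ℝ, ∀ y, ‖fderiv ℝ U y‖ ≤ K := by
  -- the DSS factor
  obtain ⟨c, hc1, hφ⟩ : ∃ c : ℝ, 1 < c ∧ ∀ (θ : ℝ) (v : EuclideanSpace ℝ (Fin 3)),
      rotZ (θ + α * (2 * Real.log c)) v = rotZ θ v := by
    by_cases hα : α = 0
    · exact ⟨2, one_lt_two, fun θ v => by rw [hα, zero_mul, add_zero]⟩
    · refine ⟨Real.exp (Real.pi / |α|), Real.one_lt_exp_iff.2 (div_pos Real.pi_pos (abs_pos.2 hα)), ?_⟩
      exact fun θ v => rotZ_add_eq_self_of_exp_pi_div_abs hα θ v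
  have hdss : IsDiscretelySelfSimilar c (pvAnsatz α (fun y _ => U y)) :=
    isDiscretelySelfSimilar_pvAnsatz (zero_lt_one.trans hc1) hφ U
  obtain ⟨P, hP⟩ := exists_isClassicalNSSolutionOn_Iio_of_rss hsol hc1 hdss hans
  have hU : ∀ y : EuclideanSpace ℝ (Fin 3), ‖U y‖ ≤ C₀ / (‖y‖ + 1) := profile_bound_of_typeI hI hans
  have hIv : ∀ t ∈ Iio (0 : ℝ), ∀ x, ‖pvAnsatz α (fun y _ => U y) t x‖ ≤ C₀ / (‖x‖ + Real.sqrt (-t)) :=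
    fun t ht x => norm_pvAnsatz_le_of_profile hU ht x
  obtain ⟨K, hK0, hK⟩ := exists_forall_iteratedFDeriv_le_of_typeI 1 C₀
  refine ⟨K, fun y => ?_⟩
  have h1 := hK _ P hP hIv (-1) (by norm_num) y
  have hslice : pvAnsatz α (fun y _ => U y) (-1) = U := funext fun x => pvAnsatz_neg_one α _ x
  rw [hslice] at h1
  have hmax : 1 ≤ max ‖y‖ (Real.sqrt (-(-1 : ℝ))) := by
    rw [neg_neg, Real.sqrt_one]; exact le_max_right _ _
  have h2 : K * ((max ‖y‖ (Real.sqrt (-(-1 : ℝ))))⁻¹) ^ (1 + 1) ≤ K := by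
    have h3 : ((max ‖y‖ (Real.sqrt (-(-1 : ℝ))))⁻¹) ^ (1 + 1) ≤ 1 :=
      pow_le_one₀ (inv_nonneg.2 (zero_le_one.trans hmax)) (inv_le_one_of_one_le₀ hmax)
    nlinarith
  have h4 : ‖fderiv ℝ U y‖ = ‖iteratedFDeriv ℝ 1 U y‖ := by
    rw [← norm_iteratedFDeriv_fderiv (n := 0), norm_iteratedFDeriv_zero]
  rw [h4]
  exact h1.trans h2

end Profile

/-- `∫ e^{−b|y|²} > 0` on `ℝ³`. [folklore] -/
theorem integral_exp_neg_mul_sq_norm_pos {b : ℝ} (hb : 0 < b) :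
    0 < ∫ y : EuclideanSpace ℝ (Fin 3), Real.exp (-b * ‖y‖ ^ 2) := by
  rw [GaussianFourier.integral_rexp_neg_mul_sq_norm hb]
  exact Real.rpow_pos_of_pos (div_pos Real.pi_pos hb) _

/-- `‖Dγ(y)‖ ≤ ½ γ(y) |y|`. [folklore] -/
theorem norm_fderiv_gaussWeight_le (y : EuclideanSpace ℝ (Fin 3)) :
    ‖fderiv ℝ (gaussWeight : EuclideanSpace ℝ (Fin 3) → ℝ) y‖ ≤ (1 / 2 : ℝ) * gaussWeight y * ‖y‖ := by
  refine ContinuousLinearMap.opNorm_le_bound _ (by have := (gaussWeight_pos y).le; positivity) fun w => ?_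
  rw [fderiv_gaussWeight_apply, Real.norm_eq_abs, abs_mul, abs_mul, abs_of_pos (gaussWeight_pos y)]
  have := abs_real_inner_le_norm y w
  rw [show |(-(1 / 2 : ℝ))| = 1 / 2 by norm_num]
  nlinarith [(gaussWeight_pos y).le, mul_nonneg (gaussWeight_pos y).le (norm_nonneg w)]

/-- Stub B2: existence of the normalised positive kernel element of the adjoint rotating-frame
operator with two-sided Gaussian bounds (Pineau–Vicol 2026, Prop. 5.1 in the rotating gauge).
[cite: PineauVicol2026, Prop. 5.1] -/
theorem stub_rotatingConjugateDensity :
    ∀ C₀ : ℝ, 0 < C₀ → ∀ A : ℝ, 0 ≤ A → ∃ c M₁ : ℝ, 0 < c ∧ 0 < M₁ ∧ ∀ (α : ℝ) (u : ℝ → EuclideanSpace ℝ (Fin 3) → EuclideanSpace ℝ (Fin 3)) (p : ℝ → EuclideanSpace ℝ (Fin 3) → ℝ) (U : EuclideanSpace ℝ (Fin 3) → EuclideanSpace ℝ (Fin 3)), |α| ≤ A → Literature.Analysis.FluidPDE.IsClassicalNSSolutionOn (Set.Ico (-1) 0) 1 0 u p → (∀ t ∈ Set.Ico (-1 : ℝ)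 0, ∀ x : EuclideanSpace ℝ (Fin 3), ‖u t x‖ ≤ C₀ / (‖x‖ + Real.sqrt (-t))) → ContDiff ℝ 2 U → (∀ t ∈ Set.Ico (-1 : ℝ) 0, ∀ x : EuclideanSpace ℝ (Fin 3), u t x = Literature.Analysis.FluidPDE.pvAnsatz α (fun y _ => U y) t x) → ∃ m : EuclideanSpace ℝ (Fin 3) → ℝ, ContDiff ℝ 2 m ∧ (∀ y, 0 < m y) ∧ (∫ y, m y = 1) ∧ (∀ y, c * Real.exp (-(7 / 16 : ℝ) * ‖y‖ ^ 2) ≤ m y) ∧ (∀ y, m y ≤ M₁ * Real.exp (-(1 / 16 : ℝ) * ‖y‖ ^ 2)) ∧ (∃ M₂ : ℝ, ∀ y, ‖fderiv ℝ m y‖ ≤ M₂ * Real.exp (-(1 / 32 : ℝ) * ‖y‖ ^ 2)) ∧ (∀ y, Laplacian.laplacian m y + Literature.Analysis.FluidPDE.VectorCalculus.divergence (fun z => m z • (U z + (1 / 2 : ℝ) • z - α • Literature.Analysis.FluidPDE.rotGen z)) y = 0) := by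
  intro C₀ hC₀ A hA
  -- constants depending on `C₀`, `A` only
  set n : ℕ := Module.finrank ℝ (EuclideanSpace ℝ (Fin 3)) with hn
  set Cm : ℝ := max (harnackConst (EuclideanSpace ℝ (Fin 3))) 1 with hCm
  have hCm1 : 1 ≤ Cm := le_max_right _ _
  set Ru : ℝ := upperRadius n C₀ (3 / 4) with hRu
  set Rb : ℝ := barrierRadius n C₀ (3 / 4) with hRb
  set Ku : ℝ := Cm ^ (⌈Ru * (C₀ + (1 / 2 + A) * (Ru + 2) + 5)⌉₊ + 1) * Real.exp ((1 - 3 / 4) * Ru ^ 2 / 4) with hKu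
  set Kl : ℝ := Cm ^ (⌈Rb * (C₀ + (1 / 2 + A) * (Rb + 2) + 5)⌉₊ + 1) with hKl
  have hKu : 0 < Ku := by positivity
  have hKl : 0 < Kl := by positivity
  set G₁ : ℝ := ∫ y : EuclideanSpace ℝ (Fin 3), Real.exp (-(1 / 16 : ℝ) * ‖y‖ ^ 2) with hG₁
  set G₇ : ℝ := ∫ y : EuclideanSpace ℝ (Fin 3), Real.exp (-(7 / 16 : ℝ) * ‖y‖ ^ 2) with hG₇
  have hG₁pos : 0 < G₁ := integral_exp_neg_mul_sq_norm_pos (by norm_num)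
  have hG₇pos : 0 < G₇ := integral_exp_neg_mul_sq_norm_pos (by norm_num)
  have hi₁ : Integrable fun y : EuclideanSpace ℝ (Fin 3) => Real.exp (-(1 / 16 : ℝ) * ‖y‖ ^ 2) :=
    integrable_exp_neg_mul_sq_norm' (by norm_num)
  have hi₇ : Integrable fun y : EuclideanSpace ℝ (Fin 3) => Real.exp (-(7 / 16 : ℝ) * ‖y‖ ^ 2) :=
    integrable_exp_neg_mul_sq_norm' (by norm_num)
  clear_value G₁ G₇
  refine ⟨1 / (Kl * (Ku * G₁)), Ku * Kl / G₇, one_div_pos.2 (mul_pos hKl (mul_pos hKu hG₁pos)),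
    div_pos (mul_pos hKu hKl) hG₇pos, ?_⟩
  intro α u p U hα hsol hI _hU2 hans
  have h : DriftHyp U C₀ := driftHyp_of_rss hsol hI hans
  obtain ⟨K, hK⟩ := exists_norm_fderiv_le_of_rss hsol hI hans
  set J : EuclideanSpace ℝ (Fin 3) →L[ℝ] EuclideanSpace ℝ (Fin 3) := α • rotGenL with hJdef
  have hJ : ∀ w, ⟪J w, w⟫ = 0 := inner_smul_rotGenL_self α
  have hJA : ‖J‖ ≤ A := (norm_smul_rotGenL_le α).trans hα
  obtain ⟨v, hv, hv2, hG2, -, hvpos, hN⟩ := exists_pos_solution_rot (U := U) h hJ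
  have hv0 := hvpos 0
  have he : ‖(EuclideanSpace.single (0 : Fin 3) (1 : ℝ))‖ = 1 := by
    rw [EuclideanSpace.single, PiLp.norm_single, norm_one]
  -- the two-sided bounds, `ε = ¾`
  have hup : ∀ y, v y * gaussProfile (-((3 / 4 : ℝ) / 4)) y ≤ Ku * v 0 := fun y =>
    upper_bound_rot h hJ hA hJA hv hvpos hv2 hN (by norm_num) (by norm_num) he y
  have hlow : ∀ y, v 0 / Kl * gaussProfile (-((3 / 4 : ℝ) / 2)) y ≤ v y * gaussProfile (-((3 / 4 : ℝ) / 4)) y := fun y =>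
    lower_bound_rot h hJ hA hJA hv hvpos hN (by norm_num) (by norm_num) he y
  clear_value Ku Kl
  have hγeq : ∀ y : EuclideanSpace ℝ (Fin 3), gaussWeight y =
      gaussProfile (-((3 / 4 : ℝ) / 4)) y * Real.exp (-(1 / 16 : ℝ) * ‖y‖ ^ 2) := by
    intro y
    rw [congrFun gaussWeight_eq y, gaussProfile, ← Real.exp_add]; congr 1; ring
  have hwup : ∀ y, gaussWeight y * v y ≤ Ku * v 0 * Real.exp (-(1 / 16 : ℝ) * ‖y‖ ^ 2) := by
    intro y
    rw [hγeq y, mul_right_comm]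
    exact mul_le_mul_of_nonneg_right (by rw [mul_comm]; exact hup y) (Real.exp_pos _).le
  have hwlow : ∀ y, v 0 / Kl * Real.exp (-(7 / 16 : ℝ) * ‖y‖ ^ 2) ≤ gaussWeight y * v y := by
    intro y
    have e : Real.exp (-(7 / 16 : ℝ) * ‖y‖ ^ 2) = gaussProfile (-((3 / 4 : ℝ) / 2)) y * Real.exp (-(1 / 16 : ℝ) * ‖y‖ ^ 2) := by
      rw [gaussProfile, ← Real.exp_add]; congr 1; ring
    have h1 := mul_le_mul_of_nonneg_right (hlow y) (Real.exp_pos (-(1 / 16 : ℝ) * ‖y‖ ^ 2)).le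
    calc v 0 / Kl * Real.exp (-(7 / 16 : ℝ) * ‖y‖ ^ 2)
        = v 0 / Kl * gaussProfile (-((3 / 4 : ℝ) / 2)) y * Real.exp (-(1 / 16 : ℝ) * ‖y‖ ^ 2) := by rw [e]; ring
      _ ≤ v y * gaussProfile (-((3 / 4 : ℝ) / 4)) y * Real.exp (-(1 / 16 : ℝ) * ‖y‖ ^ 2) := h1
      _ = gaussWeight y * v y := by rw [hγeq y]; ring
  -- the normalisation
  have hwint : Integrable fun y => gaussWeight y * v y := integrable_gaussWeight_mul_of_memLp hv2
  set Z : ℝ := ∫ y, gaussWeight y * v y with hZ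
  have hZup : Z ≤ Ku * v 0 * G₁ := by
    rw [hZ, hG₁, ← integral_const_mul]
    exact integral_mono hwint (hi₁.const_mul _) hwup
  have hZlow : v 0 / Kl * G₇ ≤ Z := by
    rw [hZ, hG₇, ← integral_const_mul]
    exact integral_mono (hi₇.const_mul _) hwint hwlow
  have hZpos : 0 < Z := lt_of_lt_of_le (by positivity) hZlow
  clear_value Z
  set m : EuclideanSpace ℝ (Fin 3) → ℝ := fun y => gaussWeight y * (Z⁻¹ * v y) with hm
  have hmw : ∀ y, m y = Z⁻¹ * (gaussWeight y * v y) := fun y => by simp only [hm]; ring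
  have hmpos : ∀ y, 0 < m y := fun y => by rw [hmw]; exact mul_pos (inv_pos.2 hZpos) (mul_pos (gaussWeight_pos y) (hvpos y))
  refine ⟨m, ?_, hmpos, ?_, ?_, ?_, ?_, ?_⟩
  · exact (contDiff_gaussWeight.mul (contDiff_const.mul hv)).of_le (by norm_cast)
  · simp_rw [hmw]
    rw [integral_const_mul, ← hZ, inv_mul_cancel₀ hZpos.ne']
  · intro y
    rw [hmw]
    have h1 : Z⁻¹ * (v 0 / Kl * Real.exp (-(7 / 16 : ℝ) * ‖y‖ ^ 2)) ≤ Z⁻¹ * (gaussWeight y * v y) :=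
      mul_le_mul_of_nonneg_left (hwlow y) (inv_pos.2 hZpos).le
    refine le_trans ?_ h1
    have h2 : (Ku * v 0 * G₁)⁻¹ ≤ Z⁻¹ := (inv_le_inv₀ (by positivity) hZpos).2 hZup
    have h3 : 1 / (Kl * (Ku * G₁)) * Real.exp (-(7 / 16 : ℝ) * ‖y‖ ^ 2) =
        (Ku * v 0 * G₁)⁻¹ * (v 0 / Kl * Real.exp (-(7 / 16 : ℝ) * ‖y‖ ^ 2)) := by
      field_simp
    rw [h3]
    exact mul_le_mul_of_nonneg_right h2 (by positivity)
  · intro y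
    rw [hmw]
    have h1 : Z⁻¹ * (gaussWeight y * v y) ≤ Z⁻¹ * (Ku * v 0 * Real.exp (-(1 / 16 : ℝ) * ‖y‖ ^ 2)) :=
      mul_le_mul_of_nonneg_left (hwup y) (inv_pos.2 hZpos).le
    refine h1.trans ?_
    have h2 : Z⁻¹ ≤ (v 0 / Kl * G₇)⁻¹ := (inv_le_inv₀ hZpos (by positivity)).2 hZlow
    have h3 : Ku * Kl / G₇ * Real.exp (-(1 / 16 : ℝ) * ‖y‖ ^ 2) =
        (v 0 / Kl * G₇)⁻¹ * (Ku * v 0 * Real.exp (-(1 / 16 : ℝ) * ‖y‖ ^ 2)) := by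
      field_simp
    rw [h3]
    exact mul_le_mul_of_nonneg_right h2 (by positivity)
  · -- gradient bound
    have hVb : ∀ z, v z ≤ Ku * v 0 * Real.exp ((3 / 16 : ℝ) * ‖z‖ ^ 2) := by
      intro z
      have h1 := hwup z
      rw [congrFun gaussWeight_eq z] at h1
      have h2 := mul_le_mul_of_nonneg_left h1 (Real.exp_pos ((1 / 4 : ℝ) * ‖z‖ ^ 2)).le
      rw [← mul_assoc, ← Real.exp_add, show (1 / 4 : ℝ) * ‖z‖ ^ 2 + -(1 / 4 : ℝ) * ‖z‖ ^ 2 = 0 by ring,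
        Real.exp_zero, one_mul] at h2
      refine h2.trans (le_of_eq ?_)
      rw [mul_comm (Real.exp _), mul_assoc, ← Real.exp_add]; congr 2; ring
    obtain ⟨M₂, hM₂⟩ := exists_gaussian_gradient_bound h α hK hv hvpos hN hVb
    refine ⟨Z⁻¹ * M₂, fun y => ?_⟩
    have hγd : DifferentiableAt ℝ (gaussWeight : EuclideanSpace ℝ (Fin 3) → ℝ) y :=
      (contDiff_gaussWeight (n := 1)).differentiable one_ne_zero y
    have hvd : DifferentiableAt ℝ v y := (hv.differentiable (by simp)) y
    have hwd : DifferentiableAt ℝ (fun y => gaussWeight y * v y) y := hγd.mul hvd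
    have e : m = fun y => Z⁻¹ * (gaussWeight y * v y) := funext hmw
    rw [e, fderiv_const_mul hwd, fderiv_fun_mul hγd hvd, norm_smul, Real.norm_eq_abs,
      abs_of_pos (inv_pos.2 hZpos), mul_assoc]
    refine mul_le_mul_of_nonneg_left (le_trans ?_ (hM₂ y)) (inv_pos.2 hZpos).le
    calc ‖gaussWeight y • fderiv ℝ v y + v y • fderiv ℝ gaussWeight y‖
        ≤ ‖gaussWeight y • fderiv ℝ v y‖ + ‖v y • fderiv ℝ gaussWeight y‖ := norm_add_le _ _
      _ ≤ gaussWeight y * ‖fderiv ℝ v y‖ + v y * ((1 / 2 : ℝ) * gaussWeight y * ‖y‖) := by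
          rw [norm_smul, norm_smul, Real.norm_of_nonneg (gaussWeight_pos y).le, Real.norm_of_nonneg (hvpos y).le]
          exact add_le_add le_rfl (mul_le_mul_of_nonneg_left (norm_fderiv_gaussWeight_le y) (hvpos y).le)
      _ = gaussWeight y * ‖fderiv ℝ v y‖ + gaussWeight y * ((1 / 2 : ℝ) * ‖y‖ * v y) := by ring
  · -- the equation
    intro y
    have hX₀1 : ContDiff ℝ 1 (fun z : EuclideanSpace ℝ (Fin 3) => (1 / 2 : ℝ) • z + (U z - J z)) :=
      (contDiff_id.const_smul (1 / 2 : ℝ)).add ((h.contDiff.sub J.contDiff).of_le (mod_cast le_top))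
    have h1 := adjN_const_mul (hv.of_le (by norm_cast)) hX₀1 Z⁻¹ y
    rw [hN y, mul_zero] at h1
    unfold adjN at h1
    have e : (fun z : EuclideanSpace ℝ (Fin 3) => m z • (U z + (1 / 2 : ℝ) • z - α • rotGen z)) =
        fun z => (gaussWeight z * (Z⁻¹ * v z)) • ((1 / 2 : ℝ) • z + (U z - J z)) := by
      funext z
      simp only [hm, hJdef, _root_.FunLike.coe_smul, Pi.smul_apply, rotGenL_apply]
      congr 1
      abel
    rw [e]
    exact h1

end Summit.NavierStokesRegularity.NavierStokesRegularity.Theorems
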